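import Summits.CriticalPhenomena.SAWScalingLimit.Theses.SAWThetaPercolation
import Summits.CriticalPhenomena.SAWScalingLimit.Theorems.PinchFreeSLE6.Negative.NonNullObligation
import Literature.Probability.RandomPlanarGeometry.ConformalRestrictionHolds
import Literature.Probability.RandomPlanarGeometry.SLEExistenceNeEightHolds

/-!
# Birth skeleton (BC3) for the crux `SAWThetaPercolation.PinchFreeSLE6`

Crux item stmt-CriticalPhenomena-17995 (rank 2, the deciding continuum crux "PINCH-FREE SLE₆ IS
SLE_{8/3}") of `route-CriticalPhenomena-SAWThetaPercolation` (`CriticalPhenomena/SAWScalingLimit`),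
concluded BY NAME by `PinchFreeSLE6_of` below:

  for every Dobrushin domain `(D; a, b)` and every chordal SLE₆ law `μ` in `D`, the conditioned laws
  `μ_ε := (μ E_ε)⁻¹ • μ|E_ε`, `E_ε = good ε D = {no double point γ s = γ t (s < t) with
  diam γ[s,t] ≥ ε} ∩ {range ∩ ∂D ⊆ B(a,ε) ∪ B(b,ε)}`, converge in law (identity variable on
  `CurveClass ℂ`, mesh parameter `ε → 0⁺`) to chordal SLE_{8/3} in `D`.

## The line: support ⟶ cutoff limit (restriction-exact, simple) ⟶ cutoff universality ⟶ LSW 2003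

* `stub_pinchFreeEventPos` (S, SUPPORT THEOREM FOR SLE₆ — the obligation made explicit by the landed
  negative-lane lemma `Theorems.PinchFreeSLE6.Negative.frequently_conditioningEvent_ne_zero`): for every
  SLE₆ law `μ` of `D` and every `ε > 0` the pinch-free / wall-free event has positive `μ`-mass,
  `μ (good ε D) ≠ 0` (so that `μ_ε` is an honest conditional probability law, not the zero measure).
  Intended proof: the support theorem for the SLE trace in the uniform-modulo-reparametrisation metric
  around a smooth chord `η` of `D` from `a` to `b` (a curve `ε'`-close to `η` in `d_U` has all its
  double-point loops of diameter `≤ 4ε'` and meets `∂D` only `ε'`-near `a, b`).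
* `stub_pinchFreeLimit` (L, THE CUTOFF LIMIT EXISTS AND IS A SIMPLE RESTRICTION FAMILY): granted (S),
  there is ONE chordal family `P` (`ChordalFamily.IsChordal`) with the two-sided restriction property
  (`ChordalFamily.IsRestriction`, exact — inherited for each `ε` from SLE₆ locality against hulls
  `ε`-away from `a, b`), carried by simple curves meeting `∂D` only at `a, b`, such that in EVERY
  Dobrushin domain and for EVERY SLE₆ law `μ` of it, `μ_ε → P D` weakly as `ε → 0⁺` (tightness à la
  Aizenman–Burchard from SLE₆ arm bounds + uniqueness of the subsequential limits; this is where the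
  refuter's large-deviation objection "μ_ε collapses onto length-minimising chords" is decided: a
  collapsed limit touching `∂D` in a non-convex `D` violates the wall clause).
* `stub_pinchFreeCovariant` (C, CUTOFF UNIVERSALITY = conformal covariance of the limit, the crux's
  declared "one real input"): ANY chordal family arising as the `ε → 0⁺` limit of the conditioned SLE₆
  laws in every domain is conformally covariant (`ChordalFamily.IsConformallyCovariant`): the Euclidean
  `ε`-cutoff, which is not conformally invariant, washes out in the limit.  The crux's own declared
  failure mode ("a restriction-exact, scale-invariant but NOT conformally covariant limit — a
  counterexample to R*") is exactly `¬ C` given (L).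

`PinchFreeSLE6_of` (S) → (L) → (C) → crux is a REAL proof: `P` from (L) applied to (S); covariance from
(C); the tree THEOREM `LawlerSchrammWerner2003_holds` ([LSW03] p. 5 result 2, sorry-free in tree:
chordal + conformally covariant + restriction + simple ⇒ `IsSLELaw (8/3) D (P D)` in every `D`); and the
proved glue `convergesInLawToSLE_of_tendstoLaw_id` (an SLE law is `preWiener.map Γ` for an SLE curve `Γ`;
`integral_map` turns weak convergence to `P D` into `TendstoLaw` to `Γ`; the identity variable is
measurable).  No stub is the crux or the summit reworded: (S) has no limit object, (L) has no SLE_{8/3}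
and no covariance, (C) has no existence (BC3 probes `stub → PinchFreeSLE6`, `stub → SAWScalingLimit`
by `first | exact? | simpa | aesop` all fail; see the registering seat's NOTES.md / `Lines/birth.md`).

Disproof used: no `Disproof.lean` on file for this crux; the landed negative-lane lemma
`Negative.frequently_conditioningEvent_ne_zero` (crux ⇒ `∃ᶠ ε → 0⁺, μ (good ε D) ≠ 0`) is honoured by
making its obligation the explicit stub (S) (in the stronger, intended `∀ ε > 0` form), consumed by (L);
`pinchFreeEventPos_necessary` below records (proved) that the crux forces the `∃ᶠ` shadow of (S).
Negatives index (`ledger negatives --problem CriticalPhenomena`): no all-`δ`/all-`ε` uniform tightness is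
asserted (stmt-CriticalPhenomena-0772-type); every limit is along `𝓝[>] 0` per domain.
-/

namespace Summit.CriticalPhenomena.SAWScalingLimit.Cruxes.PinchFreeSLE6.Birth

open MeasureTheory Filter Topology Set
open Literature.Probability.RandomPlanarGeometry
open scoped BoundedContinuousFunction NNReal ENNReal

/-! ### The three statements of the line, named

The pinch-free / wall-free event `good ε D` and the conditioning combinator `cond μ S = (μ S)⁻¹ • μ|S`
are INLINED verbatim from the crux (tree vocabulary only), so that each stub lands as a
`Theorems/SAWThetaPercolationPinchFreeSLE6<Stub>.lean --supports stmt-CriticalPhenomena-17995` file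
without importing this workfile. -/

/-- **(S) Support theorem: the conditioning events are SLE₆-non-null.** For every Dobrushin domain
`D`, every chordal SLE₆ law `μ` of `D` and every `ε > 0`, the event "no double point closing a loop of
diameter `≥ ε`, and no contact with `∂D` outside `B(a,ε) ∪ B(b,ε)`" has positive `μ`-mass. -/
def PinchFreeEventPos : Prop :=
    ∀ (D : DobrushinDomain) (μ : Measure (CurveClass ℂ)), IsSLELaw 6 D μ → ∀ ε : ℝ, 0 < ε →
      μ {c : CurveClass ℂ | (∀ γ : Curve ℂ, CurveClass.mk γ = c → ∀ s t : unitInterval, s < t →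
            γ s = γ t → Metric.diam (γ '' Set.Icc s t) < ε) ∧
          c.range ∩ frontier D.carrier ⊆ Metric.ball (D.pt 0) ε ∪ Metric.ball (D.pt 1) ε} ≠ 0

/-- **(L) The cutoff limit exists and is a simple, restriction-exact chordal family.** Granted (S),
there is a chordal family `P` — probability laws on curves of `D̄` from `a` to `b`
(`ChordalFamily.IsChordal`) — with the two-sided restriction property (`ChordalFamily.IsRestriction`),
carried by simple curves meeting `∂D` only at the marked points, such that for every Dobrushin domain
`D` and every SLE₆ law `μ` of `D` the conditioned laws `μ_ε` converge weakly to `P D` as `ε → 0⁺`. -/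
def PinchFreeLimit : Prop :=
    (∀ (D : DobrushinDomain) (μ : Measure (CurveClass ℂ)), IsSLELaw 6 D μ → ∀ ε : ℝ, 0 < ε →
      μ {c : CurveClass ℂ | (∀ γ : Curve ℂ, CurveClass.mk γ = c → ∀ s t : unitInterval, s < t →
            γ s = γ t → Metric.diam (γ '' Set.Icc s t) < ε) ∧
          c.range ∩ frontier D.carrier ⊆ Metric.ball (D.pt 0) ε ∪ Metric.ball (D.pt 1) ε} ≠ 0) →
    ∃ P : ChordalFamily, P.IsChordal ∧ P.IsRestriction ∧
      (∀ D : DobrushinDomain, ∀ᵐ γ ∂(P D),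
        γ ∈ CurveClass.simple ∧ γ.range ∩ frontier D.carrier ⊆ {D.pt 0, D.pt 1}) ∧
      ∀ (D : DobrushinDomain) (μ : Measure (CurveClass ℂ)), IsSLELaw 6 D μ →
        TendstoLaw (Ωδ := fun _ => CurveClass ℂ) (fun _ c => c)
          (fun ε => (μ {c : CurveClass ℂ | (∀ γ : Curve ℂ, CurveClass.mk γ = c →
                ∀ s t : unitInterval, s < t → γ s = γ t → Metric.diam (γ '' Set.Icc s t) < ε) ∧
              c.range ∩ frontier D.carrier ⊆ Metric.ball (D.pt 0) ε ∪ Metric.ball (D.pt 1) ε})⁻¹ •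
            μ.restrict {c : CurveClass ℂ | (∀ γ : Curve ℂ, CurveClass.mk γ = c →
                ∀ s t : unitInterval, s < t → γ s = γ t → Metric.diam (γ '' Set.Icc s t) < ε) ∧
              c.range ∩ frontier D.carrier ⊆ Metric.ball (D.pt 0) ε ∪ Metric.ball (D.pt 1) ε})
          id (P D)

/-- **(C) Cutoff universality: the pinch-free limit is conformally covariant.** Every chordal family
that is, in every Dobrushin domain and for every SLE₆ law of it, the weak `ε → 0⁺` limit of the
conditioned laws `μ_ε` is conformally covariant (`ChordalFamily.IsConformallyCovariant`: for every
conformal `g : D → D'` with boundary values `a ↦ a'`, `b ↦ b'`, `P D' = Φ_* (P D)`). -/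
def PinchFreeCovariant : Prop :=
    ∀ P : ChordalFamily, P.IsChordal →
      (∀ (D : DobrushinDomain) (μ : Measure (CurveClass ℂ)), IsSLELaw 6 D μ →
        TendstoLaw (Ωδ := fun _ => CurveClass ℂ) (fun _ c => c)
          (fun ε => (μ {c : CurveClass ℂ | (∀ γ : Curve ℂ, CurveClass.mk γ = c →
                ∀ s t : unitInterval, s < t → γ s = γ t → Metric.diam (γ '' Set.Icc s t) < ε) ∧
              c.range ∩ frontier D.carrier ⊆ Metric.ball (D.pt 0) ε ∪ Metric.ball (D.pt 1) ε})⁻¹ •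
            μ.restrict {c : CurveClass ℂ | (∀ γ : Curve ℂ, CurveClass.mk γ = c →
                ∀ s t : unitInterval, s < t → γ s = γ t → Metric.diam (γ '' Set.Icc s t) < ε) ∧
              c.range ∩ frontier D.carrier ⊆ Metric.ball (D.pt 0) ε ∪ Metric.ball (D.pt 1) ε})
          id (P D)) →
      P.IsConformallyCovariant

/-! ### The stubs (the ONLY `sorry`s of the file)

Each stub is stated over TREE VOCABULARY ONLY (verbatim the body of the named statement above);
`Registered.stub_*` below are the reducible aliases under which the skeleton audit admits them as
hypotheses of `PinchFreeSLE6_of`. -/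

/-- Stub S = `PinchFreeEventPos` verbatim (support theorem: the conditioning events are non-null). -/
theorem stub_pinchFreeEventPos :
    ∀ (D : DobrushinDomain) (μ : Measure (CurveClass ℂ)), IsSLELaw 6 D μ → ∀ ε : ℝ, 0 < ε →
      μ {c : CurveClass ℂ | (∀ γ : Curve ℂ, CurveClass.mk γ = c → ∀ s t : unitInterval, s < t →
            γ s = γ t → Metric.diam (γ '' Set.Icc s t) < ε) ∧
          c.range ∩ frontier D.carrier ⊆ Metric.ball (D.pt 0) ε ∪ Metric.ball (D.pt 1) ε} ≠ 0 := by
  sorry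

/-- Stub L = `PinchFreeLimit` verbatim (the cutoff limit exists: chordal, restriction-exact, simple,
wall-avoiding, the weak limit of the conditioned SLE₆ laws in every domain). -/
theorem stub_pinchFreeLimit :
    (∀ (D : DobrushinDomain) (μ : Measure (CurveClass ℂ)), IsSLELaw 6 D μ → ∀ ε : ℝ, 0 < ε →
      μ {c : CurveClass ℂ | (∀ γ : Curve ℂ, CurveClass.mk γ = c → ∀ s t : unitInterval, s < t →
            γ s = γ t → Metric.diam (γ '' Set.Icc s t) < ε) ∧
          c.range ∩ frontier D.carrier ⊆ Metric.ball (D.pt 0) ε ∪ Metric.ball (D.pt 1) ε} ≠ 0) →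
    ∃ P : ChordalFamily, P.IsChordal ∧ P.IsRestriction ∧
      (∀ D : DobrushinDomain, ∀ᵐ γ ∂(P D),
        γ ∈ CurveClass.simple ∧ γ.range ∩ frontier D.carrier ⊆ {D.pt 0, D.pt 1}) ∧
      ∀ (D : DobrushinDomain) (μ : Measure (CurveClass ℂ)), IsSLELaw 6 D μ →
        TendstoLaw (Ωδ := fun _ => CurveClass ℂ) (fun _ c => c)
          (fun ε => (μ {c : CurveClass ℂ | (∀ γ : Curve ℂ, CurveClass.mk γ = c →
                ∀ s t : unitInterval, s < t → γ s = γ t → Metric.diam (γ '' Set.Icc s t) < ε) ∧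
              c.range ∩ frontier D.carrier ⊆ Metric.ball (D.pt 0) ε ∪ Metric.ball (D.pt 1) ε})⁻¹ •
            μ.restrict {c : CurveClass ℂ | (∀ γ : Curve ℂ, CurveClass.mk γ = c →
                ∀ s t : unitInterval, s < t → γ s = γ t → Metric.diam (γ '' Set.Icc s t) < ε) ∧
              c.range ∩ frontier D.carrier ⊆ Metric.ball (D.pt 0) ε ∪ Metric.ball (D.pt 1) ε})
          id (P D) := by
  sorry

/-- Stub C = `PinchFreeCovariant` verbatim (cutoff universality: the limit family is conformally
covariant). -/
theorem stub_pinchFreeCovariant :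
    ∀ P : ChordalFamily, P.IsChordal →
      (∀ (D : DobrushinDomain) (μ : Measure (CurveClass ℂ)), IsSLELaw 6 D μ →
        TendstoLaw (Ωδ := fun _ => CurveClass ℂ) (fun _ c => c)
          (fun ε => (μ {c : CurveClass ℂ | (∀ γ : Curve ℂ, CurveClass.mk γ = c →
                ∀ s t : unitInterval, s < t → γ s = γ t → Metric.diam (γ '' Set.Icc s t) < ε) ∧
              c.range ∩ frontier D.carrier ⊆ Metric.ball (D.pt 0) ε ∪ Metric.ball (D.pt 1) ε})⁻¹ •
            μ.restrict {c : CurveClass ℂ | (∀ γ : Curve ℂ, CurveClass.mk γ = c →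
                ∀ s t : unitInterval, s < t → γ s = γ t → Metric.diam (γ '' Set.Icc s t) < ε) ∧
              c.range ∩ frontier D.carrier ⊆ Metric.ball (D.pt 0) ε ∪ Metric.ball (D.pt 1) ε})
          id (P D)) →
      P.IsConformallyCovariant := by
  sorry

/-! ### Registered names of the stub statements

The skeleton audit (`#h21_check_skeleton`) admits as hypotheses of `PinchFreeSLE6_of` only
propositions whose head constant is NAMED like a declared stub, so each statement gets a reducible
alias carrying its stub's name. -/
namespace Registered

/-- `PinchFreeEventPos`, under the name of its stub. -/
abbrev stub_pinchFreeEventPos : Prop := PinchFreeEventPos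
/-- `PinchFreeLimit`, under the name of its stub. -/
abbrev stub_pinchFreeLimit : Prop := PinchFreeLimit
/-- `PinchFreeCovariant`, under the name of its stub. -/
abbrev stub_pinchFreeCovariant : Prop := PinchFreeCovariant

end Registered

/-! ### Proved glue -/

/-- **Weak convergence to an SLE law is convergence in law to SLE.** If `ν` is a chordal SLE_κ law of
`D` and the laws `F ε` on curve classes converge weakly to `ν` as `ε → 0⁺` (`TendstoLaw` with the
identity variable on both sides), then the identity variable under `F ε` converges in law to chordal
SLE_κ (`ConvergesInLawToSLE`): `ν = preWiener.map Γ` for an SLE_κ random curve `Γ`, `integral_map`,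
and the identity is measurable. -/
theorem convergesInLawToSLE_of_tendstoLaw_id {κ : ℝ≥0} {D : DobrushinDomain}
    {F : ℝ → Measure (CurveClass ℂ)} {ν : Measure (CurveClass ℂ)} (hν : IsSLELaw κ D ν)
    (hF : TendstoLaw (Ωδ := fun _ => CurveClass ℂ) (fun _ c => c) F id ν) :
    ConvergesInLawToSLE κ D (Ωδ := fun _ => CurveClass ℂ) (fun _ c => c) F := by
  obtain ⟨Γ, hΓ, rfl⟩ := hν
  refine ⟨Γ, hΓ, Eventually.of_forall fun _ => aemeasurable_id, fun f => ?_⟩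
  have h := hF f
  simp only [id] at h
  rwa [integral_map hΓ.aemeasurable f.continuous.aestronglyMeasurable] at h

/-! ### The skeleton theorem: (S) → (L) → (C) → the crux, BY NAME -/

/-- **`PinchFreeSLE6` from the line `birth`** (kernel-checked, no `sorry` of its own): the cutoff
limit `P` of (L) (fed the support theorem (S)) is chordal, restriction-exact and simple/wall-avoiding;
(C) makes it conformally covariant; the tree theorem `LawlerSchrammWerner2003_holds` identifies `P D`
as the chordal SLE_{8/3} law of every `D`; `convergesInLawToSLE_of_tendstoLaw_id` turns the weak
convergence `μ_ε → P D` into the crux's `ConvergesInLawToSLE (8/3)`.  Hypotheses = the three stubs,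
under their registered names. -/
theorem PinchFreeSLE6_of (hS : Registered.stub_pinchFreeEventPos) (hL : Registered.stub_pinchFreeLimit)
    (hC : Registered.stub_pinchFreeCovariant) :
    Summit.CriticalPhenomena.SAWScalingLimit.Theses.SAWThetaPercolation.PinchFreeSLE6 := by
  dsimp only [Registered.stub_pinchFreeEventPos, Registered.stub_pinchFreeLimit,
    Registered.stub_pinchFreeCovariant, PinchFreeEventPos, PinchFreeLimit, PinchFreeCovariant]
    at hS hL hC
  -- the cutoff limit family and its structure
  obtain ⟨P, hchordal, hrestr, hsimple, hlim⟩ := hL hS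
  -- cutoff universality
  have hcov : P.IsConformallyCovariant := hC P hchordal hlim
  -- [LSW03] p. 5 result 2 (tree theorem): `P D` is the chordal SLE(8/3) law of every `D`
  have hsle : ∀ D : DobrushinDomain, IsSLELaw ((8 : ℝ≥0) / 3) D (P D) :=
    LawlerSchrammWerner2003_holds P hchordal hcov hrestr hsimple
  -- the crux
  unfold Summit.CriticalPhenomena.SAWScalingLimit.Theses.SAWThetaPercolation.PinchFreeSLE6
  dsimp only
  intro D μ hμ
  exact convergesInLawToSLE_of_tendstoLaw_id (hsle D) (hlim D μ hμ)

/-- **The crux proof modulo the stubs** (wiring check: the three stubs, exactly as stated over tree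
vocabulary, feed the skeleton theorem; this term becomes the crux proof when the last `sorry` above is
discharged — it has no `sorry` of its own). -/
theorem PinchFreeSLE6_proof :
    Summit.CriticalPhenomena.SAWScalingLimit.Theses.SAWThetaPercolation.PinchFreeSLE6 :=
  PinchFreeSLE6_of stub_pinchFreeEventPos stub_pinchFreeLimit stub_pinchFreeCovariant

/-! ### Sanity: the support stub is forced by the crux (its `∃ᶠ` shadow), by the landed negative lemma -/

/-- The crux itself forces the `∃ᶠ ε → 0⁺` shadow of stub (S) — the landed negative-lane lemma
`Negative.frequently_conditioningEvent_ne_zero`, restated here to record that (S) is an obligation of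
ANY proof of the crux, not an artefact of this line. -/
theorem pinchFreeEventPos_necessary
    [Fact Literature.Probability.Process.isProjectiveLimit_preWienerMeasure]
    (h : Summit.CriticalPhenomena.SAWScalingLimit.Theses.SAWThetaPercolation.PinchFreeSLE6)
    (D : DobrushinDomain) (μ : Measure (CurveClass ℂ)) (hμ : IsSLELaw 6 D μ) :
    ∃ᶠ ε in 𝓝[>] (0:ℝ),
      μ {c | (∀ γ : Curve ℂ, CurveClass.mk γ = c → ∀ s t : unitInterval, s < t → γ s = γ t →
            Metric.diam (γ '' Set.Icc s t) < ε) ∧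
          c.range ∩ frontier D.carrier ⊆ Metric.ball (D.pt 0) ε ∪ Metric.ball (D.pt 1) ε} ≠ 0 :=
  Summit.CriticalPhenomena.SAWScalingLimit.Theorems.PinchFreeSLE6.Negative.frequently_conditioningEvent_ne_zero
    h D μ hμ

end Summit.CriticalPhenomena.SAWScalingLimit.Cruxes.PinchFreeSLE6.Birth
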